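import Mathlib.LinearAlgebra.UnitaryGroup
import Mathlib.LinearAlgebra.Matrix.Permutation
import Mathlib.Probability.ProbabilityMassFunction.Constructions
import Mathlib.Probability.Distributions.Uniform
import Mathlib.Computability.Encoding
import Mathlib.Computability.Language
import Mathlib.Data.Set.BoolIndicator
import Mathlib.Analysis.Complex.Basic
import Literature.Computability.Cryptography.QubitRegister
import Literature.Computability.Complexity.TimeBounds
import Literature.Computability.Complexity.BoolEncodings
import HarnessLib

-- provenance: harness21/H21/H21/Prelude/CryptoQuantFine/QuantumCircuit.lean @ ebc9bd5 (interim HEAD d8f2665); M5 mechanical rewrite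
/-!
# Quantum circuits and oracle quantum circuits (trunk CryptoQuantFine, outline Q2)

This prelude file realises the notions `quantum_circuit` and `oracle_quantum_circuit` (syntax and
matrix semantics) of the CryptoQuantFine outline, on top of Q1 (`QubitRegister`):

* syntax: a gate of a circuit over the gate set `G` on `n` wires is either a placed gate symbol
  `QGate.gate g e` or a placed oracle query `QGate.oracle k e` on `k` query wires and one answer
  wire; a circuit `QCircuit G n` is a list of gates (first gate acts first); size, number of
  oracle queries, ASAP depth, concatenation;
* semantics relative to an oracle language `A : Language Bool`: `oracleGate A k` is the standard
  XOR query `|q, b⟩ ↦ |q, b ⊕ A(q)⟩`, `QGate.toMatrix A`, `QCircuit.toMatrix A` (product of the gate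
  matrices, first gate rightmost), the oracle-free semantics `QCircuit.mat C := C.toMatrix 0`
  (`0 : Language Bool` is the empty language), `runOn`, the Born-rule quantities `probEvent`,
  `acceptProb` (measure wire `0` after running on `|x⟩|0^m⟩`), the normalised Born distribution
  `bornPMF` and `outputPMF`;
* circuit families `QCircuitFamily G` (one circuit on `n + ancillas n` wires per input length `n`),
  `IsOracleFree`, `IsPolySize`, `acceptProbOn`, the classical output kernel `kernel`/`kernelProb`
  (the interface consumed by G10's PQC statements, outline R12), raw Boolean encoders
  `QGate.encode`, `QCircuit.encode`, `QCircuit.sigmaEncode` and poly-time uniformity `IsUniform`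
  (via G01's `Literature.Computability.Complexity.PolyTimeComputable` from the unary input length).

## Sources

* M. A. Nielsen, I. L. Chuang, *Quantum Computation and Quantum Information* (2000), §4.1–4.5
  (circuits, Born rule, ancillas), §6.1 (oracle `|q, b⟩ ↦ |q, b ⊕ f(q)⟩`).
* E. Bernstein, U. Vazirani, *Quantum complexity theory*, SIAM J. Comput. 26 (1997), §8 (oracle
  quantum machines).
* A. C.-C. Yao, *Quantum circuit complexity*, FOCS 1993 (uniform circuit families, BQP via circuits).

## Mathlib

Used: `Matrix.unitaryGroup`, `Equiv.Perm.permMatrix`, `Matrix.mulVec` (`*ᵥ`), `Matrix.of`, `PMF`, `PMF.ofFintype`,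
`PMF.uniformOfFintype`, `PMF.map`, `PMF.toOuterMeasure`, `Set.boolIndicator`, `Language`,
`Computability.encodeNat`, `Computability.unaryEncodeNat`, `Encodable.encode`, `Finset.sup`.
Mathlib has no quantum circuits (searched: `QuantumCircuit`, `qubit`, `quantum gate`, `Born`).
From H21: `QReg`, `basisState`, `padInput`, `placeGate`, `QGateSet` (Q1); `PolyTimeComputable` (G01
TimeBounds); `boolPair`, `encodingListNatBool` (G01 BoolEncodings).

## Design choices

* Only `[Encodable G.Op]` is ever assumed (for the encoders); no finiteness of the gate alphabet.
* Oracle gates are part of the single syntax; `IsOracleFree` singles out ordinary circuits, and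
  `toMatrix_eq_of_isOracleFree` shows their semantics do not depend on the oracle.
* `QCircuit.toMatrix A C = (C.gates.map (QGate.toMatrix A)).reverse.prod`: the head of the gate
  list acts first, so it is the rightmost factor.
* Junk values (documented at the definitions): `acceptProb` on the empty register (`n + m = 0`)
  is `0`; `bornPMF` of the zero vector is the uniform distribution (never reached for unitary gate
  sets, `outputPMF_apply`); the ASAP layer of a `0`-ary gate is `1`.
* `acceptProb` is a plain finite sum of squared amplitudes (no normalisation), so it may exceed
  `1` for non-unitary gate sets; `acceptProb_le_one` assumes `G.IsUnitary`.
* Encoders are raw injective functions into `List Bool` (G01's `PolyTimeComputable` takes raw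
  encoders); in `sigmaEncode` the ancilla count is written in unary so that uniform families are
  polynomial-size including their ancillas (`IsUniform.isPolySize`); with a binary ancilla count a
  poly-time machine could describe exponentially many idle wires.
-/

open Matrix Computability Literature.Computability.Complexity

namespace Literature.Computability.Cryptography

variable {G : QGateSet} {n m : ℕ}

/-! ### Syntax -/

/-- A gate of a quantum circuit on `n` wires over the gate set `G`: either a gate symbol `g` of `G`
placed on the wires `e : Fin (G.arity g) ↪ Fin n`, or an oracle query on `k` query wires
`e 0, …, e (k-1)` and the answer wire `e k`. (Nielsen–Chuang §4.2, §6.1; Bernstein–Vazirani 1997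
§8.) [cite: BernsteinVazirani1997, §8] -/
inductive QGate (G : QGateSet) (n : ℕ)
  /-- A placed gate of the gate set. -/
  | gate (g : G.Op) (e : Fin (G.arity g) ↪ Fin n)
  /-- A placed oracle query with `k` query wires and one answer wire (the last one). -/
  | oracle (k : ℕ) (e : Fin (k + 1) ↪ Fin n)

/-- A quantum circuit on `n` wires over the gate set `G` (possibly with oracle gates): a list of
placed gates, applied in order (the head of the list acts first). (Nielsen–Chuang §4.2; Yao 1993.)
[cite: Yao1993] -/
@[ext]
structure QCircuit (G : QGateSet) (n : ℕ) where
  /-- The gates of the circuit, in order of application. -/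
  gates : List (QGate G n)

namespace QGate

/-- A gate is oracle-free if it is not an oracle query. (Bernstein–Vazirani 1997 §8.) [cite: BernsteinVazirani1997, §8] -/
def IsOracleFree : QGate G n → Prop
  | .gate _ _ => True
  | .oracle _ _ => False

/-- Oracle-freeness of a gate is decidable (by the constructor). [folklore] -/
instance : DecidablePred (IsOracleFree (G := G) (n := n)) := fun g => by
  cases g <;> unfold IsOracleFree <;> infer_instance

/-- The set of wires a gate acts on (the range of its placement embedding).
(Nielsen–Chuang §4.2.) [folklore] -/
def wires : QGate G n → Finset (Fin n)
  | .gate _ e => Finset.univ.map e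
  | .oracle _ e => Finset.univ.map e

end QGate

namespace QCircuit

/-- A circuit is oracle-free if all its gates are. (Bernstein–Vazirani 1997 §8.) [cite: BernsteinVazirani1997, §8] -/
def IsOracleFree (C : QCircuit G n) : Prop := ∀ g ∈ C.gates, g.IsOracleFree

/-- The size (number of gates, oracle queries included) of a circuit. (Nielsen–Chuang §4.5;
Yao 1993.) [cite: Yao1993] -/
def size (C : QCircuit G n) : ℕ := C.gates.length

/-- The number of oracle queries (oracle gates) of a circuit. (Bernstein–Vazirani 1997 §8.) [cite: BernsteinVazirani1997, §8] -/
def oracleQueries (C : QCircuit G n) : ℕ := (C.gates.filter fun g => ¬ g.IsOracleFree).length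

/-- Auxiliary for `QCircuit.depth`: ASAP layering. Given the current layer `d i` of the last
gate touching each wire `i`, place the gates of the list one by one, each on layer
`1 + max {d i | i a wire of the gate}`, and return the final wire layers. (Nielsen–Chuang §4.2,
circuit depth.) [folklore] -/
def depthAux : List (QGate G n) → (Fin n → ℕ) → (Fin n → ℕ)
  | [], d => d
  | g :: gs, d => depthAux gs fun i => if i ∈ g.wires then g.wires.sup d + 1 else d i

/-- The depth of a circuit: the number of layers of the ASAP (as-soon-as-possible) layering, in
which every gate is placed one layer after the latest earlier gate sharing a wire with it. The
empty circuit has depth `0`; a `0`-ary gate sits on layer `1` but touches no wire and is not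
counted (junk case, gate sets in use have positive arities). (Nielsen–Chuang §4.2; Yao 1993.) [cite: Yao1993] -/
def depth (C : QCircuit G n) : ℕ := Finset.univ.sup (depthAux C.gates fun _ => 0)

/-- Concatenation of circuits on the same wires: run `C`, then `D`. (Nielsen–Chuang §4.2.) [folklore] -/
def append (C D : QCircuit G n) : QCircuit G n := ⟨C.gates ++ D.gates⟩

/-- The gate list of a concatenation. [folklore] -/
@[simp] theorem gates_append (C D : QCircuit G n) : (C.append D).gates = C.gates ++ D.gates := rfl

/-- Size is additive under concatenation. [folklore] -/
@[simp] theorem size_append (C D : QCircuit G n) : (C.append D).size = C.size + D.size := by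
  simp [size, append]

end QCircuit

/-! ### Semantics -/

/-- The XOR oracle gate of a language `A ⊆ {0,1}*` on `k` query wires and one answer wire (the
last wire): the permutation matrix of `|q, b⟩ ↦ |q, b ⊕ [q ∈ A]⟩`, `q ∈ {0,1}^k`.
(Nielsen–Chuang §6.1.1; Bernstein–Vazirani 1997 §8.) [cite: BernsteinVazirani1997, §8] -/
noncomputable def oracleGate (A : Language Bool) (k : ℕ) :
    Matrix (QReg (k + 1)) (QReg (k + 1)) ℂ :=
  Matrix.of fun x y =>
    if (∀ i : Fin k, x i.castSucc = y i.castSucc) ∧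
        x (Fin.last k) =
          (y (Fin.last k) ^^ A.boolIndicator (List.ofFn fun i : Fin k => y i.castSucc))
    then 1 else 0

/-- Oracle gates are unitary (they are permutation matrices of involutions).
(Nielsen–Chuang §6.1.1.) [cite: NielsenChuang2010, §6.1.1] -/
def oracleGate_mem_unitaryGroup : Prop :=
  ∀ (A : Language Bool) (k : ℕ),
    oracleGate A k ∈ Matrix.unitaryGroup (QReg (k + 1)) ℂ

namespace QGate

/-- The matrix of a placed gate relative to the oracle `A`: gate symbols denote the placement of
their matrix in `G`, oracle gates the placement of `oracleGate A k`. (Nielsen–Chuang §4.2, §6.1.)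
[folklore] -/
noncomputable def toMatrix (A : Language Bool) : QGate G n → Matrix (QReg n) (QReg n) ℂ
  | .gate g e => placeGate e (G.mat g)
  | .oracle k e => placeGate e (oracleGate A k)

/-- The matrix of a placed gate symbol (definitional). [folklore] -/
@[simp] theorem toMatrix_gate (A : Language Bool) (g : G.Op) (e : Fin (G.arity g) ↪ Fin n) :
    (QGate.gate g e : QGate G n).toMatrix A = placeGate e (G.mat g) := rfl

/-- The matrix of a placed oracle query (definitional). [folklore] -/
@[simp] theorem toMatrix_oracle (A : Language Bool) (k : ℕ) (e : Fin (k + 1) ↪ Fin n) :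
    (QGate.oracle k e : QGate G n).toMatrix A = placeGate e (oracleGate A k) := rfl

/-- The matrix of an oracle-free gate does not depend on the oracle. [folklore] -/
theorem toMatrix_eq_of_isOracleFree {g : QGate G n} (hg : g.IsOracleFree) (A B : Language Bool) :
    g.toMatrix A = g.toMatrix B := by
  cases g with
  | gate g e => rfl
  | oracle k e => exact absurd hg id

/-- The matrix of a placed gate of a unitary gate set is unitary (for any oracle).
(Nielsen–Chuang §4.2, §6.1.) [folklore] -/
def toMatrix_mem_unitaryGroup : Prop :=
  ∀ (_ : G.IsUnitary) (A : Language Bool) (g : QGate G n),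
    g.toMatrix A ∈ Matrix.unitaryGroup (QReg n) ℂ

/- interim proof relied on results that are now named facts (D-0014); demoted to a fact by the M5 import, proof preserved:
:= by
  cases g with
  | gate g e => exact placeGate_mem_unitaryGroup e (hG g)
  | oracle k e => exact placeGate_mem_unitaryGroup e (oracleGate_mem_unitaryGroup A k)
-/

end QGate

namespace QCircuit

/-- The matrix (unitary, for unitary gate sets) computed by a circuit relative to the oracle `A`:
the product of the gate matrices with the first gate as the rightmost factor.
(Nielsen–Chuang §4.2; Bernstein–Vazirani 1997 §8.) [cite: BernsteinVazirani1997, §8] -/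
noncomputable def toMatrix (A : Language Bool) (C : QCircuit G n) : Matrix (QReg n) (QReg n) ℂ :=
  (C.gates.map (QGate.toMatrix A)).reverse.prod

/-- The oracle-free semantics of a circuit: its matrix relative to the empty oracle
`0 : Language Bool`. For oracle-free circuits this is the matrix relative to any oracle
(`toMatrix_eq_of_isOracleFree`). Named `mat` in parallel with `QGateSet.mat`.
(Nielsen–Chuang §4.2.) [folklore] -/
noncomputable abbrev mat (C : QCircuit G n) : Matrix (QReg n) (QReg n) ℂ := C.toMatrix 0

/-- The empty circuit computes the identity. [folklore] -/
@[simp] theorem toMatrix_nil (A : Language Bool) : (⟨[]⟩ : QCircuit G n).toMatrix A = 1 := by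
  simp [toMatrix]

/-- Prepending a gate: it acts first, i.e. it is the rightmost factor. [folklore] -/
@[simp] theorem toMatrix_cons (A : Language Bool) (g : QGate G n) (gs : List (QGate G n)) :
    (⟨g :: gs⟩ : QCircuit G n).toMatrix A = (⟨gs⟩ : QCircuit G n).toMatrix A * g.toMatrix A := by
  simp [toMatrix]

/-- Concatenation of circuits is composition of their matrices (second circuit on the left). [folklore] -/
@[simp] theorem toMatrix_append (A : Language Bool) (C D : QCircuit G n) :
    (C.append D).toMatrix A = D.toMatrix A * C.toMatrix A := by
  simp [toMatrix, append, List.map_append, List.reverse_append, List.prod_append]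

/-- The semantics of an oracle-free circuit does not depend on the oracle.
(Bernstein–Vazirani 1997 §8.) [cite: BernsteinVazirani1997, §8] -/
theorem toMatrix_eq_of_isOracleFree {C : QCircuit G n} (hC : C.IsOracleFree)
    (A B : Language Bool) : C.toMatrix A = C.toMatrix B := by
  obtain ⟨gs⟩ := C
  induction gs with
  | nil => simp
  | cons g gs ih =>
    have hg : g.IsOracleFree := hC g (by simp)
    have hgs : (⟨gs⟩ : QCircuit G n).IsOracleFree := fun g' hg' => hC g' (by simp [hg'])
    rw [toMatrix_cons, toMatrix_cons, ih hgs, QGate.toMatrix_eq_of_isOracleFree hg A B]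

/-- The matrix of a circuit over a unitary gate set is unitary, for every oracle (oracle gates
are permutation matrices). (Nielsen–Chuang §4.2; Bernstein–Vazirani 1997 §8.) [cite: BernsteinVazirani1997, §8] -/
def toMatrix_mem_unitaryGroup : Prop :=
  ∀ (_ : G.IsUnitary) (A : Language Bool) (C : QCircuit G n),
    C.toMatrix A ∈ Matrix.unitaryGroup (QReg n) ℂ

/-- Running a circuit (relative to the oracle `A`) on an arbitrary input state `ψ`: the output
state `U_C ψ`. (Nielsen–Chuang §4.2.) [folklore] -/
noncomputable def runOn (A : Language Bool) (C : QCircuit G n) (ψ : QReg n → ℂ) : QReg n → ℂ :=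
  C.toMatrix A *ᵥ ψ

/-- **Born rule for an event.** The probability that measuring all wires of the output state of
`C` run on the input state `ψ` (relative to the oracle `A`) in the computational basis yields an
outcome in `E`: `∑_{y ∈ E} |(U_C ψ)(y)|²`. Meaningful when `ψ` is a unit vector.
(Nielsen–Chuang §2.2.5, §4.2.) [folklore] -/
noncomputable def probEvent (A : Language Bool) (C : QCircuit G n) (ψ : QReg n → ℂ)
    (E : Set (QReg n)) : ℝ :=
  open scoped Classical in ∑ y ∈ Finset.univ.filter (· ∈ E), ‖(C.runOn A ψ) y‖ ^ 2

/-- Event probabilities are nonnegative. [folklore] -/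
theorem probEvent_nonneg (A : Language Bool) (C : QCircuit G n) (ψ : QReg n → ℂ)
    (E : Set (QReg n)) : 0 ≤ C.probEvent A ψ E :=
  Finset.sum_nonneg fun _ _ => by positivity

/-- **Acceptance probability.** The probability that a circuit on `n + m` wires, run (relative to
the oracle `A`) on the basis state `|x⟩|0^m⟩` (input `x` on the first `n` wires, `m` ancillas
initialised to `0`), yields `true` when wire `0` of the output is measured:
`∑_{y, y₀ = 1} |(U_C |x 0^m⟩)(y)|²`. Junk value: on the empty register (`n + m = 0`) there is no
wire `0` and the value is `0`. (Nielsen–Chuang §4.5; Yao 1993; Bernstein–Vazirani 1997 §8.) [cite: Yao1993] -/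
noncomputable def acceptProb (A : Language Bool) (C : QCircuit G (n + m)) (x : QReg n) : ℝ :=
  ∑ y : QReg (n + m), if h : 0 < n + m then
    (if y ⟨0, h⟩ then ‖(C.runOn A (basisState (padInput x m))) y‖ ^ 2 else 0) else 0

/-- The acceptance event: outcomes whose wire `0` reads `true` (empty on the empty register). [folklore] -/
def acceptEvent (N : ℕ) : Set (QReg N) := {y | ∃ h : 0 < N, y ⟨0, h⟩ = true}

/-- The acceptance probability is the Born probability of the acceptance event on the input
`|x⟩|0^m⟩`. [folklore] -/
theorem acceptProb_eq_probEvent (A : Language Bool) (C : QCircuit G (n + m)) (x : QReg n) :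
    C.acceptProb A x = C.probEvent A (basisState (padInput x m)) (acceptEvent (n + m)) := by
  classical
  unfold acceptProb probEvent acceptEvent
  rw [Finset.sum_filter]
  refine Finset.sum_congr rfl fun y _ => ?_
  by_cases h : 0 < n + m
  · by_cases hy : y ⟨0, h⟩ = true
    · simp [h, hy]
    · simp [h, hy]
  · simp [h]

/-- Acceptance probabilities are nonnegative. [folklore] -/
theorem acceptProb_nonneg (A : Language Bool) (C : QCircuit G (n + m)) (x : QReg n) :
    0 ≤ C.acceptProb A x :=
  Finset.sum_nonneg fun _ _ => by
    split_ifs <;> positivity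

/-- Over a unitary gate set, acceptance probabilities are at most `1`. (Nielsen–Chuang §2.2.5.) [cite: NielsenChuang2010, §2.2.5] -/
def acceptProb_le_one : Prop :=
  ∀ (_ : G.IsUnitary) (A : Language Bool) (C : QCircuit G (n + m)) (x : QReg n),
    C.acceptProb A x ≤ 1

end QCircuit

/-! ### Born distributions -/

/-- **Normalised Born rule.** The probability distribution on a finite nonempty index type with
masses proportional to the squared amplitudes of `v`: `i ↦ ‖v i‖² / ∑ⱼ ‖v j‖²`. Junk value: for
the zero vector (which never arises from a unitary circuit on a basis state) it is the uniform
distribution. (Nielsen–Chuang §2.2.5.) [folklore] -/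
noncomputable def bornPMF {ι : Type*} [Fintype ι] [Nonempty ι] (v : ι → ℂ) : PMF ι :=
  if h : (∑ i, ‖v i‖ ^ 2) = 0 then PMF.uniformOfFintype ι else
    PMF.ofFintype (fun i => ENNReal.ofReal (‖v i‖ ^ 2 / ∑ j, ‖v j‖ ^ 2)) (by
      rw [← ENNReal.ofReal_sum_of_nonneg (fun i _ => div_nonneg (sq_nonneg _)
        (Finset.sum_nonneg fun j _ => sq_nonneg _)), ← Finset.sum_div, div_self h,
        ENNReal.ofReal_one])

/-- On a unit vector the Born distribution is given by the squared amplitudes themselves.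
(Nielsen–Chuang §2.2.5.) [folklore] -/
theorem bornPMF_apply_of_sum_eq_one {ι : Type*} [Fintype ι] [Nonempty ι] {v : ι → ℂ}
    (hv : ∑ i, ‖v i‖ ^ 2 = 1) (i : ι) : bornPMF v i = ENNReal.ofReal (‖v i‖ ^ 2) := by
  have h : (∑ i, ‖v i‖ ^ 2) ≠ 0 := by rw [hv]; exact one_ne_zero
  simp [bornPMF, hv, PMF.ofFintype_apply]

namespace QCircuit

/-- The output distribution of a circuit on `n + m` wires run (relative to the oracle `A`) on
`|x⟩|0^m⟩` and measured on all wires in the computational basis: the Born distribution of the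
output state. (Nielsen–Chuang §2.2.5, §4.5.) [folklore] -/
noncomputable def outputPMF (A : Language Bool) (C : QCircuit G (n + m)) (x : QReg n) :
    PMF (QReg (n + m)) :=
  bornPMF (C.runOn A (basisState (padInput x m)))

/-- Over a unitary gate set the output distribution assigns to `y` exactly the squared amplitude
`|(U_C |x 0^m⟩)(y)|²` (no normalisation is needed). (Nielsen–Chuang §2.2.5.) [cite: NielsenChuang2010, §2.2.5] -/
def outputPMF_apply : Prop :=
  ∀ (_ : G.IsUnitary) (A : Language Bool) (C : QCircuit G (n + m)) (x : QReg n) (y : QReg (n + m)),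
    C.outputPMF A x y = ENNReal.ofReal (‖(C.runOn A (basisState (padInput x m))) y‖ ^ 2)

end QCircuit

/-! ### Circuit families -/

/-- A family of quantum circuits over the gate set `G`, one for each input length `n`, acting on
the `n` input wires plus `ancillas n` ancilla wires. Uniformity and size bounds are separate
predicates (`IsUniform`, `IsPolySize`). (Yao 1993; Nielsen–Chuang §4.5.) [cite: Yao1993] -/
structure QCircuitFamily (G : QGateSet) where
  /-- The number of ancilla wires used on inputs of length `n`. -/
  ancillas : ℕ → ℕ
  /-- The circuit used on inputs of length `n`, on `n + ancillas n` wires. -/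
  circ : (n : ℕ) → QCircuit G (n + ancillas n)

namespace QCircuitFamily

/-- A circuit family is oracle-free if all its circuits are. (Bernstein–Vazirani 1997 §8.) [cite: BernsteinVazirani1997, §8] -/
def IsOracleFree (F : QCircuitFamily G) : Prop := ∀ n, (F.circ n).IsOracleFree

/-- A circuit family has polynomial size if the number of gates and the number of ancillas on
inputs of length `n` are bounded by a polynomial in `n`. (Yao 1993; Nielsen–Chuang §4.5.) [cite: Yao1993] -/
def IsPolySize (F : QCircuitFamily G) : Prop :=
  ∃ p : Polynomial ℕ, ∀ n, (F.circ n).size ≤ p.eval n ∧ F.ancillas n ≤ p.eval n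

/-- The acceptance probability of the family on a classical input `x ∈ {0,1}*` relative to the
oracle `A`: run `F.circ |x|` on `|x⟩|0…0⟩` and measure wire `0`. (Yao 1993; Bernstein–Vazirani
1997 §8.) [cite: Yao1993] -/
noncomputable def acceptProbOn (A : Language Bool) (F : QCircuitFamily G) (x : List Bool) : ℝ :=
  (F.circ x.length).acceptProb A x.get

/-- The classical input/output kernel of a circuit family relative to the oracle `A`: on input
`x`, run `F.circ |x|` on `|x⟩|0…0⟩`, measure all wires and output the resulting bit string (of
length `|x| + ancillas |x|`; any classical post-processing such as truncation is left to the
consumer). (Nielsen–Chuang §4.5; interface of outline R12 for G10.) [folklore] -/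
noncomputable def kernel (A : Language Bool) (F : QCircuitFamily G) : List Bool → PMF (List Bool) :=
  fun x => ((F.circ x.length).outputPMF A x.get).map List.ofFn

/-- The probability that the classical output of the family on input `x` (relative to the oracle
`A`) lies in the event `E ⊆ {0,1}*`. (Nielsen–Chuang §4.5; interface of outline R12 for G10.) [folklore] -/
noncomputable def kernelProb (A : Language Bool) (F : QCircuitFamily G) (x : List Bool)
    (E : Set (List Bool)) : ℝ :=
  ((F.kernel A x).toOuterMeasure E).toReal

/-- Acceptance probabilities of a family are nonnegative. [folklore] -/
theorem acceptProbOn_nonneg (A : Language Bool) (F : QCircuitFamily G) (x : List Bool) :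
    0 ≤ F.acceptProbOn A x :=
  QCircuit.acceptProb_nonneg A _ _

/-- Kernel probabilities lie in `[0, 1]`: nonnegativity. [folklore] -/
theorem kernelProb_nonneg (A : Language Bool) (F : QCircuitFamily G) (x : List Bool)
    (E : Set (List Bool)) : 0 ≤ F.kernelProb A x E :=
  ENNReal.toReal_nonneg

/-- Kernel probabilities lie in `[0, 1]`: upper bound. [folklore] -/
theorem kernelProb_le_one (A : Language Bool) (F : QCircuitFamily G) (x : List Bool)
    (E : Set (List Bool)) : F.kernelProb A x E ≤ 1 :=
  ENNReal.toReal_le_of_le_ofReal zero_le_one <| by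
    rw [ENNReal.ofReal_one, ← ((F.kernel A x).toOuterMeasure_apply_eq_one_iff Set.univ).2
      (Set.subset_univ _)]
    exact (F.kernel A x).toOuterMeasure_mono (Set.subset_univ _)

end QCircuitFamily

/-! ### Encodings and uniformity -/

namespace QGate

variable [Encodable G.Op]

/-- Raw Boolean encoding of a placed gate: a tag bit (`false` = gate symbol, `true` = oracle
query), then the `boolPair` of the binary code of the symbol (via `Encodable.encode`) resp. of the
number `k` of query wires, and the list of wire indices (`encodingListNatBool`).
(Arora–Barak 2009 §0.1, §6.1 (descriptions of circuits); Yao 1993.) [cite: AroraBarak2009, §0.1  §6.1 (descriptions of circuits] -/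
def encode : QGate G n → List Bool
  | .gate g e => false ::
      boolPair (encodeNat (Encodable.encode g))
        (encodingListNatBool.encode (List.ofFn fun i => (e i : ℕ)))
  | .oracle k e => true ::
      boolPair (encodeNat k) (encodingListNatBool.encode (List.ofFn fun i => (e i : ℕ)))

end QGate

namespace QCircuit

variable [Encodable G.Op]

/-- Raw Boolean encoding of a circuit on `n` wires: the right-nested `boolPair` list of the gate
encodings (the width `n` is not recorded; see `sigmaEncode`). (Arora–Barak 2009 §6.1; Yao 1993.)
[cite: AroraBarak2009, §6.1] -/
def encode (C : QCircuit G n) : List Bool :=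
  C.gates.foldr (fun g acc => boolPair g.encode acc) []

/-- Raw Boolean encoding of a circuit together with its number `n` of input wires and `m` of
ancilla wires: `boolPair (encodeNat n) (boolPair (unaryEncodeNat m) (encode C))`. This is the
output encoder of the uniformity condition `QCircuitFamily.IsUniform`. The ancilla count is
written in *unary*, so that the description of a circuit is at least as long as its number of
(non-input) wires, as for the standard adjacency-list descriptions of circuits; this is what makes
uniform families polynomial-size (`QCircuitFamily.IsUniform.isPolySize`), ancillas included.
(Arora–Barak 2009 §6.1; Yao 1993.) [cite: AroraBarak2009, §6.1] -/
def sigmaEncode : (Σ n m : ℕ, QCircuit G (n + m)) → List Bool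
  | ⟨n, m, C⟩ => boolPair (encodeNat n) (boolPair (unaryEncodeNat m) C.encode)

/-- `boolPair` is injective in both arguments (curried form of `boolPair_injective`). [folklore] -/
theorem boolPair_inj {a b a' b' : List Bool} (h : boolPair a b = boolPair a' b') : a = a' ∧ b = b' := by
  have := boolPair_injective (a₁ := (a, b)) (a₂ := (a', b')) h
  simpa using this

/-- `encodeNat` is injective (it has the left inverse `decodeNat`). [folklore] -/
theorem encodeNat_injective : Function.Injective encodeNat := fun m n h => by
  simpa using congrArg decodeNat h

/-- `unaryEncodeNat` is injective (left inverse `unaryDecodeNat`). [folklore] -/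
theorem unaryEncodeNat_injective : Function.Injective unaryEncodeNat := fun m n h => by
  simpa using congrArg unaryDecodeNat h

/-- The wire-list part of the gate encoding determines the embedding. [folklore] -/
theorem wires_injective {k : ℕ} :
    Function.Injective fun e : Fin k ↪ Fin n =>
      encodingListNatBool.encode (List.ofFn fun i => (e i : ℕ)) := by
  intro e e' h
  have h1 : (List.ofFn fun i => (e i : ℕ)) = List.ofFn fun i => (e' i : ℕ) :=
    encodingListNatBool.encode_injective h
  ext i
  have := congrFun (List.ofFn_injective h1) i
  exact_mod_cast this

/-- **The gate encoder is injective.** [folklore] -/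
theorem encode_injective_gate : Function.Injective (QGate.encode (G := G) (n := n)) := by
  rintro (⟨g, e⟩ | ⟨k, e⟩) (⟨g', e'⟩ | ⟨k', e'⟩) h <;>
    simp only [QGate.encode, List.cons.injEq, Bool.false_eq_true, Bool.true_eq_false,
      false_and] at h
  · obtain ⟨h1, h2⟩ := boolPair_inj h.2
    have hg : g = g' := Encodable.encode_injective (encodeNat_injective h1)
    subst hg
    rw [wires_injective h2]
  · obtain ⟨h1, h2⟩ := boolPair_inj h.2
    have hk : k = k' := encodeNat_injective h1
    subst hk
    rw [wires_injective h2]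

/-- A `boolPair` is never the empty list. [folklore] -/
theorem boolPair_ne_nil (a b : List Bool) : boolPair a b ≠ [] := by
  intro h
  have := congrArg List.length h
  simp at this

/-- **The circuit encoder is injective.** [folklore] -/
theorem encode_injective : Function.Injective (encode (G := G) (n := n)) := by
  suffices ∀ l l' : List (QGate G n),
      l.foldr (fun g acc => boolPair g.encode acc) [] =
        l'.foldr (fun g acc => boolPair g.encode acc) [] → l = l' by
    intro C C' h
    exact QCircuit.ext (this _ _ h)
  intro l
  induction l with
  | nil =>
    intro l' h
    cases l' with
    | nil => rfl
    | cons g l' => exact absurd h.symm (boolPair_ne_nil _ _)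
  | cons g l ih =>
    intro l' h
    cases l' with
    | nil => exact absurd h (boolPair_ne_nil _ _)
    | cons g' l' =>
      simp only [List.foldr_cons] at h
      obtain ⟨h1, h2⟩ := boolPair_inj h
      rw [encode_injective_gate h1, ih l' h2]

/-- **The dependent circuit encoder is injective.** [folklore] -/
theorem sigmaEncode_injective : Function.Injective (sigmaEncode (G := G)) := by
  rintro ⟨n, m, C⟩ ⟨n', m', C'⟩ h
  simp only [sigmaEncode] at h
  obtain ⟨h1, h2⟩ := boolPair_inj h
  obtain ⟨h3, h4⟩ := boolPair_inj h2
  have hn : n = n' := encodeNat_injective h1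
  have hm : m = m' := unaryEncodeNat_injective h3
  subst hn; subst hm
  rw [encode_injective h4]

end QCircuit

namespace QCircuitFamily

variable [Encodable G.Op]

/-- **Polynomial-time uniformity.** A circuit family is uniform if the map
`1^n ↦ ⟨n, ancillas n, circ n⟩` is computable in time polynomial in `n` by a Turing machine
(G01 `PolyTimeComputable`, input in unary, output under `QCircuit.sigmaEncode`).
(Yao 1993; Bernstein–Vazirani 1997 §8; Nielsen–Chuang §4.5.2.) [cite: Yao1993] -/
def IsUniform (F : QCircuitFamily G) : Prop :=
  PolyTimeComputable unaryEncodeNat (QCircuit.sigmaEncode (G := G))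
    (fun n => (⟨n, F.ancillas n, F.circ n⟩ : Σ n m : ℕ, QCircuit G (n + m)))

/-- A uniform family has polynomial size: a machine running in polynomial time writes an output
of polynomial length, and `sigmaEncode ⟨n, m, C⟩` has length at least `C.size` (every gate
contributes at least two bits) and at least `m` (unary ancilla count). (Yao 1993;
Arora–Barak 2009 §6.1.) [cite: Yao1993] -/
def IsUniform.isPolySize : Prop :=
  ∀ {F : QCircuitFamily G} (_ : F.IsUniform),
    F.IsPolySize

end QCircuitFamily

/-! ### Discharge of `oracleGate_mem_unitaryGroup` -/

section oracleGateUnitary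

variable (A : Language Bool) (k : ℕ)

/-- The classical reversible map underlying the oracle gate: `(q, b) ↦ (q, b ⊕ [q ∈ A])` on
`{0,1}^{k+1}` (query bits `q` on the first `k` coordinates, answer bit `b` on the last one).
(Nielsen–Chuang §6.1.1, eq. (6.1), p. 248.) [cite: NielsenChuang2010, §6.1.1 eq. (6.1)] -/
noncomputable def oracleFlip (y : QReg (k + 1)) : QReg (k + 1) :=
  Function.update y (Fin.last k)
    (y (Fin.last k) ^^ A.boolIndicator (List.ofFn fun i : Fin k => y i.castSucc))

/-- `oracleFlip` does not change the query bits. [folklore] -/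
@[simp] theorem oracleFlip_castSucc (y : QReg (k + 1)) (i : Fin k) :
    oracleFlip A k y i.castSucc = y i.castSucc :=
  Function.update_of_ne (Fin.castSucc_ne_last i) _ _

/-- `oracleFlip` XORs the answer bit with `[q ∈ A]`. [folklore] -/
@[simp] theorem oracleFlip_last (y : QReg (k + 1)) :
    oracleFlip A k y (Fin.last k) =
      (y (Fin.last k) ^^ A.boolIndicator (List.ofFn fun i : Fin k => y i.castSucc)) :=
  Function.update_self _ _ _

/-- `oracleFlip` is an involution (`b ⊕ f(q) ⊕ f(q) = b`). (Nielsen–Chuang §6.1.1.) [folklore] -/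
theorem oracleFlip_involutive : Function.Involutive (oracleFlip A k) := by
  intro y
  funext j
  induction j using Fin.lastCases with
  | last => simp
  | cast i => simp

/-- The oracle permutation of the computational basis `{0,1}^{k+1}`, `(q, b) ↦ (q, b ⊕ [q ∈ A])`,
as an `Equiv.Perm`. (Nielsen–Chuang §6.1.1, eq. (6.1).) [cite: NielsenChuang2010, §6.1.1 eq. (6.1)] -/
noncomputable def oracleFlipPerm : Equiv.Perm (QReg (k + 1)) :=
  Function.Involutive.toPerm _ (oracleFlip_involutive A k)

/-- `oracleFlipPerm` acts as `oracleFlip` (definitional). [folklore] -/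
@[simp] theorem oracleFlipPerm_apply (y : QReg (k + 1)) :
    oracleFlipPerm A k y = oracleFlip A k y := rfl

/-- The oracle gate is the permutation matrix of `oracleFlipPerm`: its `(x, y)` entry is
`[x = oracleFlip y]`, equivalently `[y = oracleFlip x]`. (Nielsen–Chuang §6.1.1.) [folklore] -/
theorem oracleGate_eq_permMatrix : oracleGate A k = (oracleFlipPerm A k).permMatrix ℂ := by
  ext x y
  rw [oracleGate, Matrix.of_apply, Equiv.Perm.permMatrix, PEquiv.toMatrix_toPEquiv_apply,
    Pi.single_apply, oracleFlipPerm_apply]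
  congr 1
  refine propext ⟨fun ⟨h1, h2⟩ => ?_, fun h => ?_⟩
  · funext j
    induction j using Fin.lastCases with
    | last =>
      rw [oracleFlip_last, h2, Bool.xor_assoc]
      have : (List.ofFn fun i : Fin k => y i.castSucc) = List.ofFn fun i : Fin k => x i.castSucc :=
        congrArg List.ofFn (funext fun i => (h1 i).symm)
      rw [this, Bool.xor_self, Bool.xor_false]
    | cast i => rw [oracleFlip_castSucc, h1 i]
  · subst h
    refine ⟨fun i => (oracleFlip_castSucc A k x i).symm, ?_⟩
    rw [oracleFlip_last, Bool.xor_assoc]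
    simp

/-- Permutation matrices are unitary: `P_σ * P_σ^* = P_σ * P_{σ⁻¹} = P_{σ⁻¹ σ} = 1`.
(Nielsen–Chuang §2.1.6; standard.) [folklore] -/
theorem permMatrix_mem_unitaryGroup {ι R : Type*} [Fintype ι] [DecidableEq ι] [CommRing R]
    [StarRing R] (σ : Equiv.Perm ι) : σ.permMatrix R ∈ Matrix.unitaryGroup ι R := by
  rw [Matrix.mem_unitaryGroup_iff, Matrix.star_eq_conjTranspose, Matrix.conjTranspose_permMatrix,
    ← Matrix.permMatrix_mul, inv_mul_cancel, Matrix.permMatrix_one]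

/-- **Discharge of `oracleGate_mem_unitaryGroup`.** The XOR oracle gate
`|q, b⟩ ↦ |q, b ⊕ [q ∈ A]⟩` is unitary: it is the permutation matrix (`oracleGate_eq_permMatrix`)
of the involution `oracleFlip` of the computational basis, and permutation matrices are unitary
(`permMatrix_mem_unitaryGroup`). Nielsen–Chuang state the oracle as "a unitary operator, O,
defined by its action on the computational basis |x⟩|q⟩ → |x⟩|q ⊕ f(x)⟩" (§6.1.1, eq. (6.1),
p. 248) and note for `U_f : |x, y⟩ → |x, y ⊕ f(x)⟩` that "it is easily shown to be unitary"
(§1.4.2, p. 30). [cite: NielsenChuang2010, §6.1.1 eq. (6.1) p. 248] -/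
theorem oracleGate_mem_unitaryGroup_holds : oracleGate_mem_unitaryGroup := by
  intro A k
  rw [oracleGate_eq_permMatrix]
  exact permMatrix_mem_unitaryGroup _

end oracleGateUnitary

end Literature.Computability.Cryptography
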